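import Summits.NavierStokesRegularity.NavierStokesRegularity.Theorems.ExtremiserTransienceWeakClassLocalEnergyHeadIntegrable
import Summits.NavierStokesRegularity.NavierStokesRegularity.Theorems.ExtremiserTransienceWeakClassFluxPointwise
import Summits.NavierStokesRegularity.NavierStokesRegularity.Theorems.ExtremiserTransiencePlateauSliceRigidityOfSubcubicBudget
import Mathlib.Analysis.SpecialFunctions.Integrals.Basic
import Mathlib.Analysis.SpecialFunctions.Pow.Asymptotics
import HarnessLib

/-!
# Route `ExtremiserTransience`, LINE g5-α repair (seat ns-idea-5 g5): the local energy budget holds ⇒ `PlateauSliceRigidity` (27823)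

`--supports stmt-NavierStokesRegularity-27823` and PROVES it: `plateauSliceRigidity : PlateauSliceRigidity`.
The SUBCUBIC LOCAL ENERGY BUDGET for the weak one-slice class — `∫_{B_ρ} |W(t₀)|² ≤ C(W, t₀) ρ^{11/4}` for `ρ ≥ 1` — is assembled from the landed
pieces: `weakClass_localEnergy_head'` (LEI with the cutoff `χ_ρ`, dissipation dropped, gauge-free Riesz pressure; p640551/p640802),
`weakClass_flux_pointwise` (slice-wise flux bound; p641031), the initial term `∫ χ_ρ |W(t₀ − ρ²)|² ≤ 8|B̄₁| K² ρ` (Type-I decay at depth `ρ²`), one time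
integration `∫_{t₀−ρ²}^{t₀} ds/(−s) = log(1 + ρ²/(−t₀)) ≤ 8 (1 + 1/(−t₀))^{1/8} ρ^{1/4}` (`Real.log_le_rpow_div`) and `√(1+2ρ) ≤ 2ρ^{1/2}`; then
`plateauSliceRigidity_of_subcubicBudget` (p639422: analyticity + Mityagin + constant speed + cubic mass growth) closes the item.
So LINE g5-α's transfer split now reads: `PlateauSliceTransfer` (27822, = stub S1 `plateauScalesFixed` after p637612/p638075) is the ONE open piece
between `LocalNearPlateauStability` (27676) and the crux `NearExtremalTransiencePerFlow` (26567) (`netpf_of_slice`, p633820).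
HONEST FRAMING: a rigidity statement about hypothetical Type-I ancient mild limits with an exact speed plateau of positive measure; nothing about
Navier–Stokes regularity or blow-up is proved here and no summit is proved by a line. [cite: CaffarelliKohnNirenberg1982, §2 (2.5)]
-/

noncomputable section

namespace Summit.NavierStokesRegularity.NavierStokesRegularity.Theses.ExtremiserTransience
set_option linter.dupNamespace false

open Set Function MeasureTheory Filter Topology Metric
open scoped RealInnerProductSpace ContDiff Laplacian
open Literature.Analysis Literature.Analysis.FluidPDE
open Summit.NavierStokesRegularity.NavierStokesRegularity.Theorems.ExtremiserTransience

/-- `∫_{t₀−ρ²}^{t₀} ds/(−s) = log((ρ² − t₀)/(−t₀))`. [folklore] -/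
theorem integral_inv_neg_window {t₀ ρ : ℝ} (ht₀ : t₀ < 0) :
    ∫ s in (t₀ - ρ ^ 2)..t₀, (-s)⁻¹ = Real.log ((ρ ^ 2 + -t₀) / -t₀) := by
  have h := intervalIntegral.integral_comp_neg (a := t₀ - ρ ^ 2) (b := t₀) (fun u : ℝ => u⁻¹)
  rw [h, integral_inv_of_pos (by linarith) (by nlinarith [sq_nonneg ρ])]
  congr 1
  ring

set_option maxHeartbeats 400000 in
/-- **The subcubic local energy budget** for the weak one-slice class (exponent `11/4`). [cite: CaffarelliKohnNirenberg1982, §2 (2.5)] -/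
theorem weakClass_localEnergyBudget (W : ℝ → EuclideanSpace ℝ (Fin 3) → EuclideanSpace ℝ (Fin 3)) (K : ℝ)
    (hcont : ContinuousOn (Function.uncurry W) (Set.Iio (0 : ℝ) ×ˢ Set.univ))
    (hmild : ∀ s t : ℝ, s < t → t < 0 → ∀ x, W t x =
      Literature.Analysis.FluidPDE.heatFlow (W s) (t - s) x - Literature.Analysis.FluidPDE.oseenDuhamel 1 s W W t x)
    (hdec : ∀ t : ℝ, t < 0 → ∀ x, Real.sqrt (-t) * ‖W t x‖ ≤ K) {t₀ : ℝ} (ht₀ : t₀ < 0) :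
    ∃ C α : ℝ, α < 3 ∧ ∀ ρ : ℝ, 1 ≤ ρ →
      ∫ y in Metric.ball (0 : EuclideanSpace ℝ (Fin 3)) ρ, ‖W t₀ y‖ ^ 2 ≤ C * ρ ^ α := by
  obtain ⟨B, hB0, hB⟩ := weakClass_flux_pointwise W K hcont hmild hdec
  obtain ⟨K₁, -, hg⟩ := weakClass_gradTypeI W K hcont hmild hdec
  have hK : 0 ≤ K := le_trans (mul_nonneg (Real.sqrt_nonneg _) (norm_nonneg _)) (hdec (-1) (by norm_num) 0)
  set a : ℝ := -t₀ with ha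
  have ha0 : 0 < a := neg_pos.2 ht₀
  have hsa : 0 < Real.sqrt a := Real.sqrt_pos.2 ha0
  set V₁ : ℝ := volume.real (closedBall (0 : EuclideanSpace ℝ (Fin 3)) 1) with hV₁
  have hV₁0 : 0 ≤ V₁ := measureReal_nonneg
  set D : ℝ := 1 + 2 / Real.sqrt a + 1 / (a * Real.sqrt a) with hD
  have hD0 : 0 ≤ D := by positivity
  set E : ℝ := 16 * B * D * (1 / a + 1) ^ (1 / 8 : ℝ) with hE
  have hE0 : 0 ≤ E := by positivity
  refine ⟨8 * V₁ * K ^ 2 + E, 11 / 4, by norm_num, fun ρ hρ1 => ?_⟩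
  have hρ : 0 < ρ := by linarith
  have hle : t₀ - ρ ^ 2 ≤ t₀ := by nlinarith
  obtain ⟨hhead, hFi⟩ := weakClass_localEnergy_head' W K hcont hmild hdec ht₀ hρ
  -- Step A: the ball integral is dominated by the cutoff integral
  have hφ : ContDiff ℝ ∞ (cutoff ρ : EuclideanSpace ℝ (Fin 3) → ℝ) := contDiff_cutoff ρ
  have hφc : HasCompactSupport (cutoff ρ : EuclideanSpace ℝ (Fin 3) → ℝ) := hasCompactSupport_cutoff hρ
  have hWc : Continuous (W t₀) := (hg t₀ ht₀).1.continuous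
  have hA : ∫ y in ball (0 : EuclideanSpace ℝ (Fin 3)) ρ, ‖W t₀ y‖ ^ 2 ≤ ∫ x, cutoff ρ x * ‖W t₀ x‖ ^ 2 := by
    have e : ∫ y in ball (0 : EuclideanSpace ℝ (Fin 3)) ρ, ‖W t₀ y‖ ^ 2 =
        ∫ y in ball (0 : EuclideanSpace ℝ (Fin 3)) ρ, cutoff ρ y * ‖W t₀ y‖ ^ 2 := by
      refine setIntegral_congr_fun measurableSet_ball fun y hy => ?_
      rw [cutoff_eq_one hρ (le_of_lt (mem_ball_zero_iff.1 hy)), one_mul]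
    rw [e]
    exact setIntegral_le_integral ((hφ.continuous.mul (hWc.norm.pow 2)).integrable_of_hasCompactSupport hφc.mul_right)
      (Eventually.of_forall fun x => mul_nonneg (cutoff_nonneg ρ x) (by positivity))
  -- Step B: the initial term
  have hvol : volume.real (closedBall (0 : EuclideanSpace ℝ (Fin 3)) (2 * ρ)) = 8 * ρ ^ 3 * V₁ := by
    rw [Measure.addHaar_real_closedBall' volume (0 : EuclideanSpace ℝ (Fin 3)) (by positivity : (0 : ℝ) ≤ 2 * ρ),
      finrank_euclideanSpace_fin]
    ring
  have hfin : volume (closedBall (0 : EuclideanSpace ℝ (Fin 3)) (2 * ρ)) < ⊤ := measure_closedBall_lt_top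
  have hinit : ∫ x, cutoff ρ x * ‖W (t₀ - ρ ^ 2) x‖ ^ 2 ≤ 8 * V₁ * K ^ 2 * ρ := by
    have ht1 : t₀ - ρ ^ 2 < 0 := by linarith
    have hu : 0 < -(t₀ - ρ ^ 2) := neg_pos.2 ht1
    have hsq : 0 < Real.sqrt (-(t₀ - ρ ^ 2)) := Real.sqrt_pos.2 hu
    have hWN : ∀ x, ‖W (t₀ - ρ ^ 2) x‖ ^ 2 ≤ K ^ 2 / (ρ ^ 2 + a) := by
      intro x
      have h1 : ‖W (t₀ - ρ ^ 2) x‖ ≤ K / Real.sqrt (-(t₀ - ρ ^ 2)) := by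
        rw [le_div_iff₀ hsq, mul_comm]; exact hdec _ ht1 x
      have h2 : ‖W (t₀ - ρ ^ 2) x‖ ^ 2 ≤ (K / Real.sqrt (-(t₀ - ρ ^ 2))) ^ 2 := pow_le_pow_left₀ (norm_nonneg _) h1 2
      rw [div_pow, Real.sq_sqrt hu.le] at h2
      have : -(t₀ - ρ ^ 2) = ρ ^ 2 + a := by rw [ha]; ring
      rwa [this] at h2
    have hzero : ∀ x, x ∉ closedBall (0 : EuclideanSpace ℝ (Fin 3)) (2 * ρ) → cutoff ρ x * ‖W (t₀ - ρ ^ 2) x‖ ^ 2 = 0 := by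
      intro x hx
      rw [mem_closedBall_zero_iff, not_le] at hx
      rw [cutoff_eq_zero hρ hx.le, zero_mul]
    have hbd : ∀ x ∈ closedBall (0 : EuclideanSpace ℝ (Fin 3)) (2 * ρ), ‖cutoff ρ x * ‖W (t₀ - ρ ^ 2) x‖ ^ 2‖ ≤ K ^ 2 / (ρ ^ 2 + a) := by
      intro x _
      rw [Real.norm_eq_abs, abs_of_nonneg (mul_nonneg (cutoff_nonneg ρ x) (by positivity))]
      calc cutoff ρ x * ‖W (t₀ - ρ ^ 2) x‖ ^ 2 ≤ 1 * (K ^ 2 / (ρ ^ 2 + a)) :=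
            mul_le_mul (cutoff_le_one ρ x) (hWN x) (by positivity) (by norm_num)
        _ = K ^ 2 / (ρ ^ 2 + a) := one_mul _
    have h1 : ∫ x, cutoff ρ x * ‖W (t₀ - ρ ^ 2) x‖ ^ 2 ≤ K ^ 2 / (ρ ^ 2 + a) * (8 * ρ ^ 3 * V₁) := by
      rw [← setIntegral_eq_integral_of_forall_compl_eq_zero hzero, ← hvol]
      exact (le_abs_self _).trans (by simpa [Real.norm_eq_abs] using norm_setIntegral_le_of_norm_le_const hfin hbd)
    have h2 : K ^ 2 / (ρ ^ 2 + a) * (8 * ρ ^ 3 * V₁) ≤ 8 * V₁ * K ^ 2 * ρ := by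
      rw [div_mul_eq_mul_div, div_le_iff₀ (by positivity)]
      nlinarith [mul_nonneg (mul_nonneg hV₁0 (sq_nonneg K)) (mul_nonneg hρ.le ha0.le)]
    exact h1.trans h2
  -- Step C: the flux
  set P : ℝ := ρ ^ 2 * Real.sqrt (1 + 2 * ρ) with hP
  have hP1 : ρ ^ 2 ≤ P := by
    rw [hP]
    have : 1 ≤ Real.sqrt (1 + 2 * ρ) := Real.one_le_sqrt.2 (by linarith)
    nlinarith [sq_nonneg ρ]
  have hP0 : 0 ≤ P := le_trans (sq_nonneg ρ) hP1
  have hρP : ρ ≤ P := le_trans (by nlinarith) hP1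
  have hg_le : ∀ s ∈ Icc (t₀ - ρ ^ 2) t₀,
      ρ / (-s) + ρ ^ 2 / ((-s) * Real.sqrt (-s)) + ρ ^ 2 / (s ^ 2 * Real.sqrt (-s)) +
          ρ ^ 2 * Real.sqrt (1 + 2 * ρ) / ((-s) * Real.sqrt (-s)) ≤ D * P * (-s)⁻¹ := by
    intro s hs
    have hs0 : s < 0 := lt_of_le_of_lt hs.2 ht₀
    have hu : 0 < -s := neg_pos.2 hs0
    have hau : a ≤ -s := by rw [ha]; linarith [hs.2]
    have hsu : 0 < Real.sqrt (-s) := Real.sqrt_pos.2 hu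
    have hsau : Real.sqrt a ≤ Real.sqrt (-s) := Real.sqrt_le_sqrt hau
    have e1 : ρ / (-s) ≤ P / (-s) := div_le_div_of_nonneg_right hρP hu.le
    have e2 : ρ ^ 2 / ((-s) * Real.sqrt (-s)) ≤ P / ((-s) * Real.sqrt a) :=
      div_le_div₀ hP0 hP1 (by positivity) (mul_le_mul_of_nonneg_left hsau hu.le)
    have e3 : ρ ^ 2 / (s ^ 2 * Real.sqrt (-s)) ≤ P / ((-s) * (a * Real.sqrt a)) := by
      have hss : s ^ 2 * Real.sqrt (-s) = (-s) * ((-s) * Real.sqrt (-s)) := by ring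
      rw [hss]
      exact div_le_div₀ hP0 hP1 (by positivity)
        (mul_le_mul_of_nonneg_left (mul_le_mul hau hsau hsa.le hu.le) hu.le)
    have e4 : ρ ^ 2 * Real.sqrt (1 + 2 * ρ) / ((-s) * Real.sqrt (-s)) ≤ P / ((-s) * Real.sqrt a) :=
      div_le_div₀ hP0 le_rfl (by positivity) (mul_le_mul_of_nonneg_left hsau hu.le)
    have hsum : P / (-s) + P / ((-s) * Real.sqrt a) + P / ((-s) * (a * Real.sqrt a)) + P / ((-s) * Real.sqrt a) =
        D * P * (-s)⁻¹ := by
      rw [hD]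
      field_simp
      ring
    linarith
  set G : ℝ → ℝ := fun s => B * (D * P) * (-s)⁻¹ with hGdef
  have hGi : IntervalIntegrable G volume (t₀ - ρ ^ 2) t₀ := by
    refine ContinuousOn.intervalIntegrable_of_Icc (μ := volume) hle ?_
    refine continuousOn_const.mul ((continuousOn_id.neg).inv₀ fun s hs => ?_)
    have h0 : s < 0 := lt_of_le_of_lt hs.2 ht₀
    change -s ≠ 0
    exact neg_ne_zero.2 h0.ne
  have hFG : ∀ s ∈ Icc (t₀ - ρ ^ 2) t₀,
      (∫ x, ((Δ (cutoff ρ : EuclideanSpace ℝ (Fin 3) → ℝ)) x * ‖W s x‖ ^ 2 +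
          fderiv ℝ (cutoff ρ) x (W s x) * ‖W s x‖ ^ 2 +
          2 * ((pressurePotentialMod 0 (W s) x - pressurePotentialMod 0 (W s) 0) * fderiv ℝ (cutoff ρ) x (W s x)))) ≤ G s := by
    intro s hs
    have hs0 : s < 0 := lt_of_le_of_lt hs.2 ht₀
    refine (hB ρ hρ s hs0).trans ?_
    have := mul_le_mul_of_nonneg_left (hg_le s hs) hB0
    simpa [hGdef, mul_assoc] using this
  have hflux := intervalIntegral.integral_mono_on hle hFi hGi hFG
  have hGint : ∫ s in (t₀ - ρ ^ 2)..t₀, G s = B * (D * P) * Real.log ((ρ ^ 2 + a) / a) := by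
    simp only [hGdef, intervalIntegral.integral_const_mul, integral_inv_neg_window ht₀, ha]
  -- Step D: elementary bounds `log ≤ 8 (1/a+1)^{1/8} ρ^{1/4}`, `√(1+2ρ) ≤ 2 ρ^{1/2}`
  have hlog : Real.log ((ρ ^ 2 + a) / a) ≤ 8 * (1 / a + 1) ^ (1 / 8 : ℝ) * ρ ^ (1 / 4 : ℝ) := by
    have hx0 : 0 ≤ (ρ ^ 2 + a) / a := by positivity
    have h1 := Real.log_le_rpow_div hx0 (by norm_num : (0 : ℝ) < 1 / 8)
    have h2 : (ρ ^ 2 + a) / a ≤ (1 / a + 1) * ρ ^ 2 := by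
      rw [div_le_iff₀ ha0]
      have : 1 ≤ ρ ^ 2 := by nlinarith
      have e : (1 / a + 1) * ρ ^ 2 * a = ρ ^ 2 + a * ρ ^ 2 := by field_simp
      rw [e]; linarith [mul_nonneg ha0.le (sub_nonneg.2 this), mul_sub a (ρ ^ 2) 1]
    have h3 : ((ρ ^ 2 + a) / a) ^ (1 / 8 : ℝ) ≤ ((1 / a + 1) * ρ ^ 2) ^ (1 / 8 : ℝ) :=
      Real.rpow_le_rpow hx0 h2 (by norm_num)
    have h4 : ((1 / a + 1) * ρ ^ 2) ^ (1 / 8 : ℝ) = (1 / a + 1) ^ (1 / 8 : ℝ) * ρ ^ (1 / 4 : ℝ) := by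
      rw [Real.mul_rpow (by positivity) (by positivity)]
      congr 1
      rw [← Real.rpow_natCast ρ 2, ← Real.rpow_mul hρ.le]
      norm_num
    calc Real.log ((ρ ^ 2 + a) / a) ≤ ((ρ ^ 2 + a) / a) ^ (1 / 8 : ℝ) / (1 / 8) := h1
      _ = 8 * ((ρ ^ 2 + a) / a) ^ (1 / 8 : ℝ) := by ring
      _ ≤ 8 * ((1 / a + 1) ^ (1 / 8 : ℝ) * ρ ^ (1 / 4 : ℝ)) := by rw [← h4]; gcongr
      _ = _ := by ring
  have hsqrt : Real.sqrt (1 + 2 * ρ) ≤ 2 * ρ ^ (1 / 2 : ℝ) := by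
    have h1 : Real.sqrt (1 + 2 * ρ) ≤ Real.sqrt (4 * ρ) := Real.sqrt_le_sqrt (by linarith)
    have h2 : Real.sqrt (4 * ρ) = 2 * Real.sqrt ρ := by
      rw [Real.sqrt_mul (by norm_num : (0 : ℝ) ≤ 4), show (4 : ℝ) = 2 ^ 2 by norm_num, Real.sqrt_sq (by norm_num)]
    rw [h2, Real.sqrt_eq_rpow ρ] at h1
    exact h1
  have hPle : P ≤ 2 * (ρ ^ 2 * ρ ^ (1 / 2 : ℝ)) := by
    rw [hP]; nlinarith [mul_le_mul_of_nonneg_left hsqrt (sq_nonneg ρ)]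
  have hmon : ρ ^ 2 * ρ ^ (1 / 2 : ℝ) * ρ ^ (1 / 4 : ℝ) = ρ ^ (11 / 4 : ℝ) := by
    rw [← Real.rpow_natCast ρ 2, ← Real.rpow_add hρ, ← Real.rpow_add hρ]
    norm_num
  have hfluxle : B * (D * P) * Real.log ((ρ ^ 2 + a) / a) ≤ E * ρ ^ (11 / 4 : ℝ) := by
    have hBDP : 0 ≤ B * (D * P) := by positivity
    have hx1 : 1 ≤ (ρ ^ 2 + a) / a := by
      rw [le_div_iff₀ ha0, one_mul]; linarith [sq_nonneg ρ]
    have hlog0 : 0 ≤ Real.log ((ρ ^ 2 + a) / a) := Real.log_nonneg hx1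
    calc B * (D * P) * Real.log ((ρ ^ 2 + a) / a)
        ≤ B * (D * (2 * (ρ ^ 2 * ρ ^ (1 / 2 : ℝ)))) * (8 * (1 / a + 1) ^ (1 / 8 : ℝ) * ρ ^ (1 / 4 : ℝ)) := by
          gcongr
      _ = E * (ρ ^ 2 * ρ ^ (1 / 2 : ℝ) * ρ ^ (1 / 4 : ℝ)) := by rw [hE]; ring
      _ = E * ρ ^ (11 / 4 : ℝ) := by rw [hmon]
  -- assemble
  have hρle : ρ ≤ ρ ^ (11 / 4 : ℝ) := by
    calc ρ = ρ ^ (1 : ℝ) := (Real.rpow_one ρ).symm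
      _ ≤ ρ ^ (11 / 4 : ℝ) := Real.rpow_le_rpow_of_exponent_le hρ1 (by norm_num)
  calc ∫ y in ball (0 : EuclideanSpace ℝ (Fin 3)) ρ, ‖W t₀ y‖ ^ 2 ≤ ∫ x, cutoff ρ x * ‖W t₀ x‖ ^ 2 := hA
    _ ≤ (∫ x, cutoff ρ x * ‖W (t₀ - ρ ^ 2) x‖ ^ 2) + ∫ s in (t₀ - ρ ^ 2)..t₀, ∫ x,
          ((Δ (cutoff ρ : EuclideanSpace ℝ (Fin 3) → ℝ)) x * ‖W s x‖ ^ 2 + fderiv ℝ (cutoff ρ) x (W s x) * ‖W s x‖ ^ 2 +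
          2 * ((pressurePotentialMod 0 (W s) x - pressurePotentialMod 0 (W s) 0) * fderiv ℝ (cutoff ρ) x (W s x))) := hhead
    _ ≤ 8 * V₁ * K ^ 2 * ρ + ∫ s in (t₀ - ρ ^ 2)..t₀, G s := add_le_add hinit hflux
    _ = 8 * V₁ * K ^ 2 * ρ + B * (D * P) * Real.log ((ρ ^ 2 + a) / a) := by rw [hGint]
    _ ≤ 8 * V₁ * K ^ 2 * ρ ^ (11 / 4 : ℝ) + E * ρ ^ (11 / 4 : ℝ) :=
          add_le_add (mul_le_mul_of_nonneg_left hρle (by positivity)) hfluxle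
    _ = (8 * V₁ * K ^ 2 + E) * ρ ^ (11 / 4 : ℝ) := by ring

/-- **LINE g5-α, item 27823**: `PlateauSliceRigidity` HOLDS — no Type-I ancient mild field of the weak one-slice class has an exact speed
plateau of positive measure on a slice. [cite: CaffarelliKohnNirenberg1982, §2 (2.5)] -/
theorem plateauSliceRigidity : PlateauSliceRigidity :=
  plateauSliceRigidity_of_subcubicBudget fun W K _ hcont hmild hdec ht₀ =>
    weakClass_localEnergyBudget W K hcont hmild hdec ht₀

end Summit.NavierStokesRegularity.NavierStokesRegularity.Theses.ExtremiserTransience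

end
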